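import Summits.BirchSwinnertonDyer.BirchSwinnertonDyer.Theorems.TangentConeEdgeDecayOfLayerOneUnit
import HarnessLib

/-!
# BirchSwinnertonDyer / TangentCone — crux `EdgeDecay` (stmt-BirchSwinnertonDyer-17608), line `lambda-layer-one`:
# the bridge from the line's LOGICAL CORE `C⁰` (cyclotomic order `≤ r_an` at one admissible prime)

Lead `prover-line-stmt-BirchSwinnertonDyer-17608-0`; skeleton `Cruxes/EdgeDecay/Lines/lambda_layer_one.lean` (v10).
The conditional bridge `stub_edgeDecay_of_layerOneUnit` (file `TangentConeEdgeDecayOfLayerOneUnit.lean`) consumed the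
card's C⁺ (a UNIT level-`p²` Riemann sum, `p > r_an`). Its logical core — all that the Greenberg–Stevens reading needs —
is strictly weaker:

* **C⁰ `CycOrderLeRankSomewhere`** (conjecture-grade, the line's bet in its weakest form): for `E` of analytic rank `≥ 2`
  with a big-image good ordinary prime there is an ADMISSIBLE prime `p` (good ordinary, `a_p² ≢ 1 (mod p)`, `ρ̄`
  surjective, (Br)) at which the cyclotomic `p`-adic `L`-function of the newform of `E` vanishes at `T = 0` to order
  `≤ r_an`: `ord_T L_p(f_E, α; T) ≤ r_an` — the `≤` half of the Mazur–Tate–Teitelbaum order conjecture at ONE prime of our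
  choosing (it is implied prime-by-prime by `ord_T L_p = r_an`, i.e. by the comparison crux of route PAdicOrderV2, and at a
  given `p` by IMC + `Ш[p^∞]` finite + Schneider non-degeneracy; no `μ = 0` and no unit condition is asked).

This file lands `stub_edgeDecay_of_cycOrderLeRank : C⁰ → exists_isNewformOf → greenbergStevens_kitagawa_ratio_interpolation →
EdgeDecay` (registered stub; proof = `lambdaLayerOne_gsTotalDecayLeCycOrder`, the XL stub proved from the GS fact and the
landed analytic rate lemma) and records that the card's C⁺ is a DECIDABLE SUFFICIENT CRITERION for C⁰
(`lambdaLayerOne_cycOrderLeRank_of_layerOneUnit`: the level-`p²` unit Riemann sum certifies `ord_T L_p ≤ j ≤ r_an` by the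
tree's Riemann-sum certificate, the measure being `ℤ_p`-valued at an admissible prime).
-/

set_option linter.dupNamespace false

namespace Summit.BirchSwinnertonDyer.BirchSwinnertonDyer.Theorems

open scoped Classical
open Filter Topology

/-- **C⁺ ⇒ C⁰** (the card's layer-one unit criterion implies the logical core): at an admissible prime `p > r_an`, a
unit level-`p²` Riemann sum `RS(j,1)`, `j ≤ r_an`, gives `ord_T L_p(f_E, α; T) ≤ r_an` — integrality of the measure
(`lambdaLayerOne_norm_msdMeasure_le_one`) and the certificate `lambdaLayerOne_order_le_of_layerOneUnit`. [folklore] -/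
theorem lambdaLayerOne_cycOrderLeRank_of_layerOneUnit :
    (∀ (W : WeierstrassCurve ℚ) [W.IsElliptic] [W.IsGloballyMinimal], 2 ≤ W.analyticRank → (∃ (p₀ : ℕ) (_ : Fact p₀.Prime), 5 ≤ p₀ ∧ W.HasGoodReductionAtPrime p₀ ∧ ¬ (p₀ : ℤ) ∣ W.frobeniusTrace p₀ ∧ W.HasSurjectiveModNGaloisRep p₀) → ∃ (_ : NeZero (W.conductorNorm ℤ)) (p : ℕ) (_ : Fact p.Prime), 5 ≤ p ∧ W.HasGoodReductionAtPrime p ∧ ¬ (p : ℤ) ∣ W.frobeniusTrace p ∧ ¬ (p : ℤ) ∣ (W.frobeniusTrace p) ^ 2 - 1 ∧ W.HasSurjectiveModNGaloisRep p ∧ (∀ (M : ℕ) (_ : NeZero M) (g : CuspForm (CongruenceSubgroup.Gamma0 M) 2) (ι : Literature.NumberTheory.EllipticCurves.ModularForms.coeffField g →+* PadicAlgCl p), M ∣ W.conductorNorm ℤ * p → Literature.NumberTheory.EllipticCurves.ModularForms.IsNewform0 g → ‖ι ⟨(UpperHalfPlane.qExpansion 1 ⇑g).coeff p, Literature.NumberTheory.EllipticCurves.ModularForms.coeff_mem_coeffField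 g p⟩‖ = 1 → (∀ ℓ : ℕ, ℓ.Prime → ¬ ℓ ∣ W.conductorNorm ℤ * p → ‖ι ⟨(UpperHalfPlane.qExpansion 1 ⇑g).coeff ℓ, Literature.NumberTheory.EllipticCurves.ModularForms.coeff_mem_coeffField g ℓ⟩ - ((W.frobeniusTrace ℓ : ℤ) : PadicAlgCl p)‖ < 1) → M = W.conductorNorm ℤ ∧ ∀ n : ℕ, (UpperHalfPlane.qExpansion 1 ⇑g).coeff n = ((W.LFunction n : ℤ) : ℂ)) ∧ W.analyticRank < p ∧ ∀ (f : CuspForm (CongruenceSubgroup.Gamma0 (W.conductorNorm ℤ)) 2), Literature.NumberTheory.EllipticCurves.ModularForms.IsNewformOf W f → ∃ j : ℕ, j ≤ W.analyticRank ∧ ‖Literature.NumberTheory.EllipticCurves.padicLRiemannSum f (Literature.NumberTheory.EllipticCurves.unitRoot W p : ℚ_[p]) j 1‖ = 1) → (∀ (W : WeierstrassCurve ℚ) [W.IsElliptic] [W.IsGloballyMinimal], 2 ≤ W.analyticRank → (∃ (p₀ : ℕ) (_ : Fact p₀.Prime), 5 ≤ p₀ ∧ W.HasGoodReductionAtPrime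 p₀ ∧ ¬ (p₀ : ℤ) ∣ W.frobeniusTrace p₀ ∧ W.HasSurjectiveModNGaloisRep p₀) → ∃ (_ : NeZero (W.conductorNorm ℤ)) (p : ℕ) (_ : Fact p.Prime), 5 ≤ p ∧ W.HasGoodReductionAtPrime p ∧ ¬ (p : ℤ) ∣ W.frobeniusTrace p ∧ ¬ (p : ℤ) ∣ (W.frobeniusTrace p) ^ 2 - 1 ∧ W.HasSurjectiveModNGaloisRep p ∧ (∀ (M : ℕ) (_ : NeZero M) (g : CuspForm (CongruenceSubgroup.Gamma0 M) 2) (ι : Literature.NumberTheory.EllipticCurves.ModularForms.coeffField g →+* PadicAlgCl p), M ∣ W.conductorNorm ℤ * p → Literature.NumberTheory.EllipticCurves.ModularForms.IsNewform0 g → ‖ι ⟨(UpperHalfPlane.qExpansion 1 ⇑g).coeff p, Literature.NumberTheory.EllipticCurves.ModularForms.coeff_mem_coeffField g p⟩‖ = 1 → (∀ ℓ : ℕ, ℓ.Prime → ¬ ℓ ∣ W.conductorNorm ℤ * p → ‖ι ⟨(UpperHalfPlane.qExpansion 1 ⇑g).coeff ℓ, Literature.NumberTheory.EllipticCurves.ModularForms.coeff_mem_coeffField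 g ℓ⟩ - ((W.frobeniusTrace ℓ : ℤ) : PadicAlgCl p)‖ < 1) → M = W.conductorNorm ℤ ∧ ∀ n : ℕ, (UpperHalfPlane.qExpansion 1 ⇑g).coeff n = ((W.LFunction n : ℤ) : ℂ)) ∧ ∀ (f : CuspForm (CongruenceSubgroup.Gamma0 (W.conductorNorm ℤ)) 2), Literature.NumberTheory.EllipticCurves.ModularForms.IsNewformOf W f → (Literature.NumberTheory.EllipticCurves.padicLFunction f (Literature.NumberTheory.EllipticCurves.unitRoot W p : ℚ_[p])).order ≤ W.analyticRank) := by
  intro hC W _ _ h2 hp₀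
  obtain ⟨hN, p, hp, h5, hgood, hord, hna, hsurj, hBr, hpr, hunit⟩ := hC W h2 hp₀
  refine ⟨hN, p, hp, h5, hgood, hord, hna, hsurj, hBr, fun f hf => ?_⟩
  haveI := hp
  haveI := hN
  obtain ⟨j, hjr, hju⟩ := hunit f hf
  have hμ := lambdaLayerOne_norm_msdMeasure_le_one h5 hgood hord hna hf
  have hordAt : Literature.NumberTheory.EllipticCurves.IsOrdinaryAt W p := ⟨hgood, hord⟩
  have hjp : j < p := by omega
  exact (lambdaLayerOne_order_le_of_layerOneUnit hordAt hf hμ hjp hju).trans (by exact_mod_cast hjr)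

/-- **The bridge from the logical core** (registered stub `stub_edgeDecay_of_cycOrderLeRank` of skeleton v10): C⁰
(`ord_T L_p ≤ r_an` at one admissible prime with (Br)), modularity and the Greenberg–Stevens/Kitagawa ratio
interpolation imply the crux `EdgeDecay` BY NAME. [folklore] -/
theorem stub_edgeDecay_of_cycOrderLeRank :
    (∀ (W : WeierstrassCurve ℚ) [W.IsElliptic] [W.IsGloballyMinimal], 2 ≤ W.analyticRank → (∃ (p₀ : ℕ) (_ : Fact p₀.Prime), 5 ≤ p₀ ∧ W.HasGoodReductionAtPrime p₀ ∧ ¬ (p₀ : ℤ) ∣ W.frobeniusTrace p₀ ∧ W.HasSurjectiveModNGaloisRep p₀) → ∃ (_ : NeZero (W.conductorNorm ℤ)) (p : ℕ) (_ : Fact p.Prime), 5 ≤ p ∧ W.HasGoodReductionAtPrime p ∧ ¬ (p : ℤ) ∣ W.frobeniusTrace p ∧ ¬ (p : ℤ) ∣ (W.frobeniusTrace p) ^ 2 - 1 ∧ W.HasSurjectiveModNGaloisRep p ∧ (∀ (M : ℕ) (_ : NeZero M) (g : CuspForm (CongruenceSubgroup.Gamma0 M) 2) (ι : Literature.NumberTheory.EllipticCurves.ModularForms.coeffField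 g →+* PadicAlgCl p), M ∣ W.conductorNorm ℤ * p → Literature.NumberTheory.EllipticCurves.ModularForms.IsNewform0 g → ‖ι ⟨(UpperHalfPlane.qExpansion 1 ⇑g).coeff p, Literature.NumberTheory.EllipticCurves.ModularForms.coeff_mem_coeffField g p⟩‖ = 1 → (∀ ℓ : ℕ, ℓ.Prime → ¬ ℓ ∣ W.conductorNorm ℤ * p → ‖ι ⟨(UpperHalfPlane.qExpansion 1 ⇑g).coeff ℓ, Literature.NumberTheory.EllipticCurves.ModularForms.coeff_mem_coeffField g ℓ⟩ - ((W.frobeniusTrace ℓ : ℤ) : PadicAlgCl p)‖ < 1) → M = W.conductorNorm ℤ ∧ ∀ n : ℕ, (UpperHalfPlane.qExpansion 1 ⇑g).coeff n = ((W.LFunction n : ℤ) : ℂ)) ∧ ∀ (f : CuspForm (CongruenceSubgroup.Gamma0 (W.conductorNorm ℤ)) 2), Literature.NumberTheory.EllipticCurves.ModularForms.IsNewformOf W f → (Literature.NumberTheory.EllipticCurves.padicLFunction f (Literature.NumberTheory.EllipticCurves.unitRoot W p : ℚ_[p])).order ≤ W.analyticRank) → Literature.NumberTheory.EllipticCurves.ModularForms.exists_isNewformOf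 → Literature.NumberTheory.EllipticCurves.greenbergStevens_kitagawa_ratio_interpolation → Summit.BirchSwinnertonDyer.BirchSwinnertonDyer.Theses.TangentCone.EdgeDecay := by
  intro hC hMod hGS W _ _ h2 hp₀
  obtain ⟨hN, p, hp, h5, hgood, hord, hna, hsurj, hBr, horderAll⟩ := hC W h2 hp₀
  haveI := hp
  haveI := hN
  obtain ⟨f, hf⟩ := hMod W
  obtain ⟨a, b, hb, hab, hJ⟩ :=
    lambdaLayerOne_gsTotalDecayLeCycOrder hGS W hN p h5 hgood hord hna hsurj hBr f hf W.analyticRank (horderAll f hf)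
  exact ⟨hN, p, hp, h5, hgood, hord, hna, hsurj, hBr, a, b, hb, hab, hJ⟩

end Summit.BirchSwinnertonDyer.BirchSwinnertonDyer.Theorems
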